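import Literature.Computation.FiniteGraph.IsingCorrelationCert
import Literature.Computation.FiniteGraph.IsingPolynomials
import Literature.Computation.FiniteGraph.SAWLatticeDomains
import Literature.Computation.FiniteGraph.SAWInterlacing
import HarnessLib

/-!
# Finite-graph witness engine: worked certificate files as printed by the generator (regression examples)

Topic `Literature/Computation/FiniteGraph`; everything proved, no facts, nothing declared beyond small
data `def`s and the generated theorems about them. Each section below is the VERBATIM body of the
Lean file printed by one command of the unit's generator `kit/fgwe/fgwe.py` (see
`Literature/Computation/README.lean`, Area `FiniteGraph/`, §4), on instances small enough for the
kernel to re-check at every build (seconds in total). They document the output format the dependent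
seats paste into `Summits/…/Theorems` files and act as a tripwire: if an engine API changes, this
file stops compiling and the generator must follow. Commands (outputs renamed `gen/exN.lean`):

* `fgwe.py ising nonpos --n 3 --bonds 0,1,3,5;1,2,3,5;0,2,3,5 --name triangleIM --out gen/ex1.lean`
* `fgwe.py ising polycert --n 3 --edges 0-1,1-2,0-2 --lhs 0,1;1,2 --rhs 0,2; --lo 1/100 --hi 1/2 --name triangleGKS --out gen/ex2.lean`
* `fgwe.py saw tp2 --box 0,0,2,2 --points 0,0;2,0;2,2;0,2 --name box3TP2 --out gen/ex3.lean`
* `fgwe.py saw evidence --box 0,0,2,2 --points 0,0;2,0;2,2;0,2 --name box3List --out gen/ex4.lean`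
* `fgwe.py saw fkg --box 0,0,2,2 --a 0,0 --b 2,0 --V1 1,1 --V2 0,2 --name box3FKG --out gen/ex5.lean`

[folklore] throughout.
-/

set_option maxRecDepth 100000

namespace Literature.Computation.FiniteGraph.Examples

open Literature.Computation.FiniteGraph Literature.Probability.LatticeModels
open Literature.Probability.RandomPlanarGeometry.SAW.FiniteMemory (toPair)

/-! ### `fgwe.py ising nonpos --n 3 --bonds 0,1,3,5;1,2,3,5;0,2,3,5 --name triangleIM --out gen/ex1.lean` -/

/-- Bond data `(u, v, a, b)` (`tanh K = a/b`). [folklore] -/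
def triangleIM_bonds : List IsingBond := [(0, 1, 3, 5), (1, 2, 3, 5), (0, 2, 3, 5)]

/-- The exact inverse `Σ⁻¹` (generator output, re-verified below). [folklore] -/
def triangleIM_inv : List (List ℚ) :=
  [[(323 : ℚ) / 98, (-285 : ℚ) / 196, (-285 : ℚ) / 196],
      [(-285 : ℚ) / 196, (323 : ℚ) / 98, (-285 : ℚ) / 196],
      [(-285 : ℚ) / 196, (-285 : ℚ) / 196, (323 : ℚ) / 98]]

/-- The certificate passes: `triangleIM_inv · Σ = 1` exactly and every off-diagonal entry is `≤ 0`. [folklore] -/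
theorem triangleIM_check : imNonposCheck 3 triangleIM_bonds triangleIM_inv = true := by
  decide +kernel

/-- **Inverse-`M` property of this model** (positive evidence for `InverseMFerromagnet`): for the
canonical couplings `modelK` (`Kᵢ = artanh(aᵢ/bᵢ)`) on the bonds `modelC`, every off-diagonal entry of
`Σ⁻¹` is `≤ 0`. [folklore] -/
theorem triangleIM (x y : Fin 3) (hxy : x ≠ y) :
    (Matrix.of fun r s : Fin 3 => gksExpect Finset.univ (modelK triangleIM_bonds)
      (modelC 3 triangleIM_bonds (bondsOK_of_imNonposCheck triangleIM_check))
      (fun ω => spinAt r ω * spinAt s ω))⁻¹ x y ≤ 0 :=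
  inv_entry_nonpos_of_imNonposCheck triangleIM_check x y hxy

/-! ### `fgwe.py ising polycert --n 3 --edges 0-1,1-2,0-2 --lhs 0,1;1,2 --rhs 0,2; --lo 1/100 --hi 1/2 --name triangleGKS --out gen/ex2.lean` -/

/-- The bonds (pairs of sites of `Fin 3`), all carrying the same coupling `β`, `t = tanh β`. [folklore] -/
def triangleGKS_edges : List (ℕ × ℕ) := [(0, 1), (1, 2), (0, 2)]

/-- The certificate passes: bonds well formed, and the difference `Π_rhs N_B − Π_lhs N_A` of products of
correlation numerator polynomials (integer polynomials in `t`) is positive on `[1/100, 1/2]` by the sign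
certificate of depth 0. (`diff(lo) ≈ 0.64`, `diff(hi) ≈ 18`.) [folklore] -/
theorem triangleGKS_check :
    ipCertCheck 3 triangleGKS_edges ((([[0, 1], [1, 2]] : List (List (Fin 3))).map fun A => A.map Fin.val))
      ((([[0, 2], []] : List (List (Fin 3))).map fun B => B.map Fin.val)) 0 ((1 : ℚ) / 100) ((1 : ℚ) / 2) = true := by
  decide +kernel

/-- The bonds are well formed (endpoints `< 3`, distinct). [folklore] -/
theorem triangleGKS_edgesLt : edgesLt 3 triangleGKS_edges = true := edgesLt_of_ipCertCheck triangleGKS_check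

/-- **All-coupling product inequality** (list form): for every coupling `β` with `tanh β ∈ [1/100, 1/2]`,
in the pair ferromagnet `K ≡ β` on the bonds `triangleGKS_edges` of `Fin 3`,
`Π_{A ∈ lhs} ⟨σ_A⟩_β < Π_{B ∈ rhs} ⟨σ_B⟩_β` with `lhs = [[0, 1], [1, 2]]`, `rhs = [[0, 2], []]`
(`listSpin [p, q] = σ_p σ_q`, see `listSpin_pair` / `listSpin_four`; `listSpin [] = 1`). [folklore] -/
theorem triangleGKS (β : ℝ) (hlo : (((1 : ℚ) / 100 : ℚ) : ℝ) ≤ Real.tanh β) (hhi : Real.tanh β ≤ (((1 : ℚ) / 2 : ℚ) : ℝ)) :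
    (([[0, 1], [1, 2]] : List (List (Fin 3))).map fun A => gksExpect Finset.univ (fun _ : Fin triangleGKS_edges.length => β)
        (edgeBonds 3 triangleGKS_edges triangleGKS_edgesLt) (listSpin A)).prod <
    (([[0, 2], []] : List (List (Fin 3))).map fun B => gksExpect Finset.univ (fun _ : Fin triangleGKS_edges.length => β)
        (edgeBonds 3 triangleGKS_edges triangleGKS_edgesLt) (listSpin B)).prod :=
  prod_gksExpect_lt_of_ipCertCheck triangleGKS_check β hlo hhi

/-- The same with the products written out. [folklore] -/
theorem triangleGKS' (β : ℝ) (hlo : (((1 : ℚ) / 100 : ℚ) : ℝ) ≤ Real.tanh β) (hhi : Real.tanh β ≤ (((1 : ℚ) / 2 : ℚ) : ℝ)) :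
    gksExpect Finset.univ (fun _ : Fin triangleGKS_edges.length => β) (edgeBonds 3 triangleGKS_edges triangleGKS_edgesLt) (listSpin [0, 1]) *
      gksExpect Finset.univ (fun _ : Fin triangleGKS_edges.length => β) (edgeBonds 3 triangleGKS_edges triangleGKS_edgesLt) (listSpin [1, 2]) <
    gksExpect Finset.univ (fun _ : Fin triangleGKS_edges.length => β) (edgeBonds 3 triangleGKS_edges triangleGKS_edgesLt) (listSpin [0, 2]) *
      gksExpect Finset.univ (fun _ : Fin triangleGKS_edges.length => β) (edgeBonds 3 triangleGKS_edges triangleGKS_edgesLt) (listSpin []) := by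
  simpa [mul_assoc] using triangleGKS β hlo hhi

/-! ### `fgwe.py saw tp2 --box 0,0,2,2 --points 0,0;2,0;2,2;0,2 --name box3TP2 --out gen/ex3.lean` -/

open Literature.Probability.RandomPlanarGeometry in
/-- **Strict product inequality between critical two-point SAW weights of the box
`[0,2] × [0,2]`** (mesh 1, `Z(p,q) = SAW.weight Ω 1 p q univ` at `x = x_c`):
`Z((0, 0), (2, 2)) · Z((2, 0), (0, 2)) < Z((0, 0), (2, 0)) · Z((2, 2), (0, 2))`, certified on x_c ∈ [1/3, 1/2] (axiom-clean), depth 0.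
Polynomials: `Z12Z34 − Z13Z24 = ['0', '0', '0', '0', '1', '0', '6', '0', '-17', '0', '-14', '0', '-3', '0', '4', '0', '0']` (low degree first); values at the interval ends ≈ 0.01774, 0.07568. [folklore] -/
theorem box3TP2 :
    SAW.weight (siteDomain (boxSites ![0, 0] ![2, 2])) 1 ![0, 0] ![2, 2] Set.univ *
      SAW.weight (siteDomain (boxSites ![0, 0] ![2, 2])) 1 ![2, 0] ![0, 2] Set.univ <
    SAW.weight (siteDomain (boxSites ![0, 0] ![2, 2])) 1 ![0, 0] ![2, 0] Set.univ *
      SAW.weight (siteDomain (boxSites ![0, 0] ![2, 2])) 1 ![2, 2] ![0, 2] Set.univ :=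
  box_weight_mul_weight_lt_of_posCert_third_half ![0, 0] ![2, 2] ![0, 0] ![2, 2] ![2, 0] ![0, 2] ![0, 0] ![2, 0] ![2, 2] ![0, 2] (d := 0) (by decide +kernel)

/-! ### `fgwe.py saw evidence --box 0,0,2,2 --points 0,0;2,0;2,2;0,2 --name box3List --out gen/ex4.lean` -/

/-- The site list of the domain. [folklore] -/
def box3List_sites : List (ℤ × ℤ) := boxList (0, 0) (2, 2)

/-- The site list is connected (part XI). [folklore] -/
theorem box3List_conn : connectedB box3List_sites = true := by decide +kernel

/-- `(p₁ → p₃)` is interlaced with `(p₂ → p₄)`: part XI's check passes. [folklore] -/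
theorem box3List_meets :
    meetsAllB box3List_sites (toPair ![0, 0]) (toPair ![2, 2]) (toPair ![2, 0]) (toPair ![0, 2]) = true := by
  decide +kernel

open Literature.Probability.RandomPlanarGeometry in
/-- **Interlacing**: every SAW `(0, 0) → (2, 2)` of the domain meets every SAW `(2, 0) → (0, 2)`. [folklore] -/
theorem box3List_interlaced (P : SAW.DomainSAW (siteDomain {z : Site 2 | toPair z ∈ box3List_sites}) 1 ![0, 0] ![2, 2])
    (Q : SAW.DomainSAW (siteDomain {z : Site 2 | toPair z ∈ box3List_sites}) 1 ![2, 0] ![0, 2]) :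
    ∃ v, v ∈ P.walk.support ∧ v ∈ Q.walk.support :=
  domainSAW_meets_of_meetsAllB (list_adj_iff box3List_sites box3List_conn) box3List_meets P Q

open Literature.Probability.RandomPlanarGeometry in
/-- **TP₂ holds strictly: `Z₁₃Z₂₄ < Z₁₂Z₃₄`** at `x_c` for these four points (depth 0). `Z₁₂Z₃₄ − Z₁₃Z₂₄ ≈ 0.01774, 0.07568` at the interval ends. [folklore] -/
theorem box3List_tp2 :
    SAW.weight (siteDomain {z : Site 2 | toPair z ∈ box3List_sites}) 1 ![0, 0] ![2, 2] Set.univ *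
      SAW.weight (siteDomain {z : Site 2 | toPair z ∈ box3List_sites}) 1 ![2, 0] ![0, 2] Set.univ <
    SAW.weight (siteDomain {z : Site 2 | toPair z ∈ box3List_sites}) 1 ![0, 0] ![2, 0] Set.univ *
      SAW.weight (siteDomain {z : Site 2 | toPair z ∈ box3List_sites}) 1 ![2, 2] ![0, 2] Set.univ :=
  list_weight_mul_weight_lt_of_posCert box3List_sites box3List_conn ![0, 0] ![2, 2] ![2, 0] ![0, 2]
    ![0, 0] ![2, 0] ![2, 2] ![0, 2] (lo := (1 : ℚ) / 3) (hi := (1 : ℚ) / 2) (d := 0) criticalFugacity_mem_Icc_third_half.1 criticalFugacity_mem_Icc_third_half.2 (by decide +kernel)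

/-! ### `fgwe.py saw fkg --box 0,0,2,2 --a 0,0 --b 2,0 --V1 1,1 --V2 0,2 --name box3FKG --out gen/ex5.lean` -/

open Literature.Probability.RandomPlanarGeometry in
/-- **Strict product inequality between hull-avoidance weights** of the SAWs `(0, 0) → (2, 0)` in the box
`[0,2] × [0,2]` at `x_c`: `w(avoid V₁)·w(avoid V₂) < w(avoid V₃)·w(avoid V₄)` with
`V₁ = [(1, 1)]`, `V₂ = [(0, 2)]`, `V₃ = []`, `V₄ = [(0, 2), (1, 1)]` (depth 0). `w(univ)w(A∩B) − w(A)w(B)` at the interval ends ≈ 0.0002841, 0.006348. [folklore] -/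
theorem box3FKG :
    SAW.weight (siteDomain (boxSites ![0, 0] ![2, 2])) 1 ![0, 0] ![2, 0] (avoids ![0, 0] ![2, 0] [(1, 1)]) *
      SAW.weight (siteDomain (boxSites ![0, 0] ![2, 2])) 1 ![0, 0] ![2, 0] (avoids ![0, 0] ![2, 0] [(0, 2)]) <
    SAW.weight (siteDomain (boxSites ![0, 0] ![2, 2])) 1 ![0, 0] ![2, 0] (avoids ![0, 0] ![2, 0] []) *
      SAW.weight (siteDomain (boxSites ![0, 0] ![2, 2])) 1 ![0, 0] ![2, 0] (avoids ![0, 0] ![2, 0] [(0, 2), (1, 1)]) :=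
  box_weight_avoids_mul_lt_of_posCert ![0, 0] ![2, 2] ![0, 0] ![2, 0] ![0, 0] ![2, 0] ![0, 0] ![2, 0] ![0, 0] ![2, 0] [(1, 1)] [(0, 2)] [] [(0, 2), (1, 1)] (by decide) (by decide) (by decide) (by decide) (lo := (1 : ℚ) / 3) (hi := (1 : ℚ) / 2) (d := 0) criticalFugacity_mem_Icc_third_half.1 criticalFugacity_mem_Icc_third_half.2 (by decide +kernel)

end Literature.Computation.FiniteGraph.Examples
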